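import Literature.AlgebraicGeometry.Deformation.GrothendieckExistenceVectorBundlesAffine
import Literature.AlgebraicGeometry.Resolution.FiniteOverCompleteLocal
import Mathlib.RingTheory.WittVector.Complete
import Mathlib.RingTheory.WittVector.DiscreteValuationRing
import Mathlib.AlgebraicGeometry.Morphisms.Finite
import HarnessLib

/-!
# `GortzWedhorn2023_thm2494_vectorBundle_witt` for affine `𝒳` (GW II Thm. 24.94, affine proper case)

Görtz–Wedhorn, *Algebraic Geometry II* (2023), Thm. 24.94 / Prop. 24.88. The sibling file
`GrothendieckExistenceVectorBundlesAffine` proves the conclusion of the named fact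
`Literature.AlgebraicGeometry.Deformation.GortzWedhorn2023_thm2494_vectorBundle_witt` for
`𝒳 = Spec S → Spec W(k)` with `S` `p`-adically complete. Here we discharge that completeness from
the fact's own hypothesis: for `k` a perfect field of characteristic `p`, a PROPER affine
`W(k)`-scheme `Spec S` is finite over `W(k)` (Mathlib `IsFinite.iff_isProper_and_isAffineHom`), so
`S` is a finite module over the complete discrete valuation ring `W(k)` (Mathlib
`WittVector.isAdicCompleteIdealSpanP`) and therefore `p`-adically complete (Matsumura Thm. 8.7,
`Literature.AlgebraicGeometry.Resolution.isAdicComplete_map_of_finite`):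

* `WittAffine.isAdicComplete_span_p_of_isProper`;
* **`WittAffine.thm2494_vectorBundle_witt_specOver`** — the statement of
  `GortzWedhorn2023_thm2494_vectorBundle_witt` verbatim, for `𝒳 = specOver (𝕎 k) S`.

Everything is proved; no named facts.

## References

* U. Görtz, T. Wedhorn, *Algebraic Geometry II: Cohomology of Schemes*, Springer Spektrum 2023,
  Prop. 24.88, Thm. 24.94 (pp. 562–566). [GortzWedhorn2023]
* H. Matsumura, *Commutative Ring Theory*, CUP 1986, Thm. 8.7. [Matsumura1987]
-/

noncomputable section

open CategoryTheory CategoryTheory.Limits AlgebraicGeometry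
open Literature.AlgebraicGeometry.Motives Literature.AlgebraicGeometry.Motives.WittScheme

namespace Literature.AlgebraicGeometry.Deformation

namespace WittAffine

/-! ### The fact for affine `𝒳`: properness of `Spec S → Spec W(k)` makes `S` `p`-adically complete -/

section Proper

variable (p : ℕ) [Fact p.Prime] (k : Type) [Field k] [CharP k p] [PerfectRing k p]
variable (S : Type) [CommRing S] [Algebra (WittVector p k) S]

/-- **A proper affine `W(k)`-scheme has `p`-adically complete coordinate ring** (`k` a perfect field
of characteristic `p`): `Spec S → Spec W(k)` proper and affine is finite (Mathlib
`IsFinite.iff_isProper_and_isAffineHom`), so `S` is a finite module over the complete noetherian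
ring `W(k)` (Mathlib `WittVector.isAdicCompleteIdealSpanP`, `W(k)` a discrete valuation ring) and
hence `pS`-adically complete (Matsumura Thm. 8.7,
`Literature.AlgebraicGeometry.Resolution.isAdicComplete_map_of_finite`). [folklore] -/
theorem isAdicComplete_span_p_of_isProper (h : IsProper (specOver (WittVector p k) S).hom) :
    IsAdicComplete (Ideal.span {(p : S)}) S := by
  have h' : IsProper (Spec.map (CommRingCat.ofHom (algebraMap (WittVector p k) S))) := h
  have hfin : IsFinite (Spec.map (CommRingCat.ofHom (algebraMap (WittVector p k) S))) :=
    IsFinite.iff_isProper_and_isAffineHom.mpr ⟨h', inferInstance⟩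
  have hfin' : (algebraMap (WittVector p k) S).Finite := (IsFinite.SpecMap_iff _).mp hfin
  haveI : Module.Finite (WittVector p k) S := RingHom.finite_algebraMap.mp hfin'
  have hc := Resolution.isAdicComplete_map_of_finite (WittVector p k) S
    (Ideal.span {(p : WittVector p k)})
  rwa [Ideal.map_span, Set.image_singleton, map_natCast] at hc

/-- **`GortzWedhorn2023_thm2494_vectorBundle_witt` holds for affine `𝒳 = Spec S → Spec W(k)`**:
exactly the statement of the fact (`k` perfect of characteristic `p`, `𝒳` proper over `W(k)`, a
compatible system of vector bundles on the thickenings `X_{n+1}`), for `𝒳 = specOver (𝕎 k) S`.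
[cite: GortzWedhorn2023, Thm. 24.94 and Prop. 24.88 (pp. 562–566)] -/
theorem thm2494_vectorBundle_witt_specOver (h𝒳 : IsProper (specOver (WittVector p k) S).hom)
    (E : ∀ n, (thickening (specOver (WittVector p k) S) (n + 1)).left.Modules)
    (hE : ∀ n, IsVectorBundle (E n))
    (hc : ∀ n, Nonempty ((Scheme.Modules.pullback
      (thickeningMap (specOver (WittVector p k) S) (Nat.le_succ (n + 1)))).obj (E (n + 1)) ≅ E n)) :
    ∃ F : (specOver (WittVector p k) S).left.Modules, IsVectorBundle F ∧
      ∀ n, Nonempty ((Scheme.Modules.pullback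
        (thickeningι (specOver (WittVector p k) S) (n + 1))).obj F ≅ E n) :=
  haveI := isAdicComplete_span_p_of_isProper p k S h𝒳
  exists_vectorBundle_forall_thickening_iso p k S E hE hc

end Proper

end WittAffine

end Literature.AlgebraicGeometry.Deformation
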